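import Mathlib
import HarnessLib
import Summits.Ventures.LatticeQCDFlow.Exactness.NCMCGeneralSpacePairMartingale
import Summits.Ventures.LatticeQCDFlow.Scoring.ChainBlockMarkov
import Summits.Ventures.LatticeQCDFlow.Exactness.NCMCGeneralSpaceDoeblinPower

/-!
# The SLIDING-WINDOW KERNEL of a Markov chain: `(X_k, …, X_{k+W})` is driven by the kernel
# `κ_W(y, ·) = law of (y_1, …, y_W, s)`, `s ∼ κ(y_W, ·)`, and its `n`-step transition operator is a
# path integral of the original chain

HONEST FRAMING: exact (Metropolis-corrected) sampling algorithms for lattice gauge theory;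
figures of merit are autocorrelation/cost numbers at stated couplings and volumes; no
continuum-physics claim.

Venture `LatticeQCDFlow` (cell pub-lqcd), sub-topic `Scoring`; FANOUT row 16 (`su2-base`), GEN-9.
NEW WORK of the cell (elementary; our formalisation), not a published result; nothing is cited as a
fact (the "snake chain" / sliding-block chain of a Markov chain — e.g. Kemeny–Snell 1960 §6.5,
Meyn–Tweedie 1993 §3.4 — NAMED ONLY).  WHY: every error bar the scorers print for CHAIN output
(row 16's heat-bath and HMC streams; rows 8/13's samplers) is a statistic of LAG PRODUCTS
`f(X_k) f(X_{k+t})`, `t ≤ W` — functionals of `W + 1` consecutive states.  Rows 8/13 proved the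
law of large numbers / CLT / decorrelation certificates for ONE-time observables `f(X_k)` of a
chain with a Doeblin power (`Exactness/NCMCGeneralSpaceDoeblinPowerCLT`, …); the device that turns
each of them into the same statement for window functionals is classical: the window process
`Y_k = (X_k, …, X_{k+W})` is itself a Markov chain, on `S^{W+1}`, whose kernel shifts the window and
appends a `κ`-sample.  This file defines that kernel and computes its `n`-step transition operator
as an integral against the path law of the ORIGINAL chain started at the newest coordinate — the one
formula from which the next file (`Scoring/SlidingWindowChain.lean`) reads off the Doeblin power, the
invariant law and the identification of path laws.

## Content (`κ` a Markov kernel on `S`; `W : ℕ`; `P_{μ₀}` row 8's chain law `Kernel.trajMeasure …`)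

* `shiftIn W y s = (y_1, …, y_W, s)`, `splicePath W y x = (y_0, …, y_{W−1}, x_0, x_1, …)`,
  `windowPath W x k = (x_k, …, x_{k+W})` [ours; bookkeeping maps] with their pointwise algebra
  (`shiftIn_windowPath`: shifting the `k`-th window in `x_{k+W+1}` gives the `(k+1)`-st;
  `windowPath_splicePath_last`, `windowPath_splicePath_succ`, `windowPath_splicePath_add`);
* **`windowKernel κ W`** [ours] — the sliding-window kernel on `Fin (W+1) → S`, a Markov kernel, with
  `windowKernel_apply : κ_W(y) = κ(y_W, ·).map (shiftIn W y)` and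
  `kop_windowKernel : (κ_W g)(y) = ∫ g(shiftIn W y s) κ(y_W, ds)`;
* `chain_integral_eval_zero` — `∫ G(x_0) dP_{μ₀} = ∫ G dμ₀` (bookkeeping);
* **`iterate_kop_windowKernel`** — THE `n`-STEP FORMULA: for bounded measurable `g`, every `n` and `y`,
  `((κ_W)^n g)(y) = ∫ g(windowPath W (splicePath W y x) n) dP_{δ_{y_W}}(x)`: run the original chain from
  the newest coordinate `y_W`, prepend the older coordinates, read the `n`-th window (induction on `n`;
  the step is row 13's joint tower identity `Exactness.GeneralNCMC.chain_tower_joint`).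

NOT CLAIMED here (next file): the Doeblin power of `κ_W`, its invariant law, the identification of the
law of `(Y_k)_k` under `P_{μ₀}` with the `κ_W`-chain; anything quantitative.
-/

noncomputable section

open MeasureTheory ProbabilityTheory Filter Finset Preorder
open scoped ENNReal Topology
open Summit.Ventures.LatticeQCDFlow.Exactness Summit.Ventures.LatticeQCDFlow.Exactness.GeneralNCMC

namespace Summit.Ventures.LatticeQCDFlow.Scoring

variable {S : Type*}

/-! ## Bookkeeping maps on windows and paths (no measurable structure needed) -/

section Maps

variable (W : ℕ)

/-- Shift a window and append a new last coordinate: `shiftIn W y s = (y_1, …, y_W, s)`. [ours] -/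
def shiftIn (y : Fin (W + 1) → S) (s : S) : Fin (W + 1) → S :=
  fun i => if h : (i : ℕ) < W then y ⟨i + 1, by omega⟩ else s

/-- Prepend the first `W` coordinates of a window to a path:
`splicePath W y x = (y_0, …, y_{W−1}, x_0, x_1, …)`. [ours] -/
def splicePath (y : Fin (W + 1) → S) (x : ℕ → S) : ℕ → S :=
  fun k => if h : k < W then y ⟨k, by omega⟩ else x (k - W)

/-- The path of windows of a path: `windowPath W x k = (x_k, …, x_{k+W})`. [ours] -/
def windowPath (x : ℕ → S) : ℕ → (Fin (W + 1) → S) := fun k i => x (k + i)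

variable {W}

/-- `shiftIn` below the last coordinate reads the next coordinate of the window. -/
theorem shiftIn_apply_of_lt (y : Fin (W + 1) → S) (s : S) {i : Fin (W + 1)} (h : (i : ℕ) < W) :
    shiftIn W y s i = y ⟨i + 1, by omega⟩ := by
  simp only [shiftIn, h, dif_pos]

/-- `shiftIn` at the last coordinate is the appended point. -/
theorem shiftIn_apply_of_not_lt (y : Fin (W + 1) → S) (s : S) {i : Fin (W + 1)} (h : ¬ (i : ℕ) < W) :
    shiftIn W y s i = s := by
  simp only [shiftIn, h, dif_neg, not_false_eq_true]

/-- `shiftIn W y s (Fin.last W) = s`. -/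
theorem shiftIn_last (y : Fin (W + 1) → S) (s : S) : shiftIn W y s (Fin.last W) = s :=
  shiftIn_apply_of_not_lt y s (by simp)

/-- `splicePath` reads the window below index `W`. -/
theorem splicePath_of_lt (y : Fin (W + 1) → S) (x : ℕ → S) {k : ℕ} (h : k < W) :
    splicePath W y x k = y ⟨k, by omega⟩ := by
  simp only [splicePath, h, dif_pos]

/-- `splicePath` reads the path from index `W` on: `splicePath W y x (k + W) = x k`. -/
theorem splicePath_add (y : Fin (W + 1) → S) (x : ℕ → S) (k : ℕ) :
    splicePath W y x (k + W) = x k := by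
  simp only [splicePath, show ¬ (k + W < W) by omega, dif_neg, not_false_eq_true, Nat.add_sub_cancel]

/-- Two paths that agree up to time `n` give splices that agree up to time `n + W`. -/
theorem splicePath_congr (y : Fin (W + 1) → S) {x x' : ℕ → S} {n : ℕ} (h : ∀ j ≤ n, x j = x' j)
    {k : ℕ} (hk : k ≤ n + W) : splicePath W y x k = splicePath W y x' k := by
  by_cases hkW : k < W
  · rw [splicePath_of_lt y x hkW, splicePath_of_lt y x' hkW]
  · simp only [splicePath, hkW, dif_neg, not_false_eq_true]
    exact h _ (by omega)

/-- `windowPath W x k i = x (k + i)`. -/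
theorem windowPath_apply (x : ℕ → S) (k : ℕ) (i : Fin (W + 1)) : windowPath W x k i = x (k + i) := rfl

/-- The last coordinate of the `k`-th window is `x_{k+W}`. -/
theorem windowPath_last (x : ℕ → S) (k : ℕ) : windowPath W x k (Fin.last W) = x (k + W) := by
  simp only [windowPath, Fin.val_last]

/-- **Shifting the `k`-th window in `x_{k+W+1}` gives the `(k+1)`-st window.** -/
theorem shiftIn_windowPath (x : ℕ → S) (k : ℕ) :
    shiftIn W (windowPath W x k) (x (k + W + 1)) = windowPath W x (k + 1) := by
  funext i
  by_cases h : (i : ℕ) < W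
  · rw [shiftIn_apply_of_lt _ _ h, windowPath_apply, windowPath_apply]
    congr 1
    simp only
    omega
  · rw [shiftIn_apply_of_not_lt _ _ h, windowPath_apply]
    congr 1
    have hi : (i : ℕ) = W := by have := i.is_lt; omega
    omega

/-- The last coordinate of the `n`-th window of the splice is `x_n`. -/
theorem windowPath_splicePath_last (y : Fin (W + 1) → S) (x : ℕ → S) (n : ℕ) :
    windowPath W (splicePath W y x) n (Fin.last W) = x n := by
  rw [windowPath_last, splicePath_add]

/-- The `(n+1)`-st window of the splice is the shift of the `n`-th window in `x_{n+1}`. -/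
theorem windowPath_splicePath_succ (y : Fin (W + 1) → S) (x : ℕ → S) (n : ℕ) :
    windowPath W (splicePath W y x) (n + 1) = shiftIn W (windowPath W (splicePath W y x) n) (x (n + 1)) := by
  rw [← shiftIn_windowPath (splicePath W y x) n, show n + W + 1 = (n + 1) + W by omega, splicePath_add]

/-- Far windows of the splice are windows of the path: `windowPath W (splicePath W y x) (n + W) = windowPath W x n`. -/
theorem windowPath_splicePath_add (y : Fin (W + 1) → S) (x : ℕ → S) (n : ℕ) :
    windowPath W (splicePath W y x) (n + W) = windowPath W x n := by
  funext i
  rw [windowPath_apply, windowPath_apply, show n + W + (i : ℕ) = (n + i) + W by omega, splicePath_add]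

/-- The `0`-th window of the splice is `y` with its last coordinate replaced by `x_0`. -/
theorem windowPath_splicePath_zero (y : Fin (W + 1) → S) (x : ℕ → S) :
    windowPath W (splicePath W y x) 0
      = fun i : Fin (W + 1) => if h : (i : ℕ) < W then y ⟨i, by omega⟩ else x 0 := by
  funext i
  rw [windowPath_apply]
  by_cases h : (i : ℕ) < W
  · rw [dif_pos h, splicePath_of_lt y x (show 0 + (i : ℕ) < W by omega)]
    congr 1
    ext
    simp
  · rw [dif_neg h]
    simp only [splicePath, show ¬ (0 + (i : ℕ) < W) by omega, dif_neg, not_false_eq_true]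
    congr 1
    have := i.is_lt
    omega

/-- Replacing the last coordinate of `y` by `y_W` gives back `y`. -/
theorem replaceLast_self (y : Fin (W + 1) → S) :
    (fun i : Fin (W + 1) => if h : (i : ℕ) < W then y ⟨i, by omega⟩ else y (Fin.last W)) = y := by
  funext i
  by_cases h : (i : ℕ) < W
  · rw [dif_pos h]
  · rw [dif_neg h]
    congr 1
    ext
    rw [Fin.val_last]
    have := i.is_lt
    omega

/-- Shifts of the `n`-th windows of two splices agree when the paths agree up to time `n`. -/
theorem shiftIn_windowPath_splicePath_congr (y : Fin (W + 1) → S) {x x' : ℕ → S} {n : ℕ}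
    (h : ∀ j ≤ n, x j = x' j) (s : S) :
    shiftIn W (windowPath W (splicePath W y x) n) s = shiftIn W (windowPath W (splicePath W y x') n) s := by
  funext i
  by_cases hi : (i : ℕ) < W
  · rw [shiftIn_apply_of_lt _ _ hi, shiftIn_apply_of_lt _ _ hi, windowPath_apply, windowPath_apply]
    exact splicePath_congr y h (by simp only; omega)
  · rw [shiftIn_apply_of_not_lt _ _ hi, shiftIn_apply_of_not_lt _ _ hi]

end Maps

/-! ### Measurability -/

section Measurability

variable [MeasurableSpace S] {W : ℕ}

/-- `shiftIn` of measurable arguments is measurable. -/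
theorem measurable_shiftIn {α : Type*} [MeasurableSpace α] {v : α → (Fin (W + 1) → S)} {u : α → S}
    (hv : Measurable v) (hu : Measurable u) : Measurable fun a => shiftIn W (v a) (u a) := by
  refine measurable_pi_lambda _ fun i => ?_
  by_cases h : (i : ℕ) < W
  · simp only [shiftIn, h, dif_pos]
    exact (measurable_pi_apply _).comp hv
  · simp only [shiftIn, h, dif_neg, not_false_eq_true]
    exact hu

/-- `shiftIn W y` is measurable. -/
theorem measurable_shiftIn_right (y : Fin (W + 1) → S) : Measurable (shiftIn W y) :=
  measurable_shiftIn measurable_const measurable_id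

/-- Each coordinate of the splice is a measurable function of the path. -/
theorem measurable_splicePath_apply (y : Fin (W + 1) → S) (k : ℕ) :
    Measurable fun x : ℕ → S => splicePath W y x k := by
  by_cases h : k < W
  · simp only [splicePath, h, dif_pos]
    exact measurable_const
  · simp only [splicePath, h, dif_neg, not_false_eq_true]
    exact measurable_pi_apply _

/-- The windows of the splice are measurable functions of the path. -/
theorem measurable_windowPath_splicePath (y : Fin (W + 1) → S) (n : ℕ) :
    Measurable fun x : ℕ → S => windowPath W (splicePath W y x) n :=
  measurable_pi_lambda _ fun _ => measurable_splicePath_apply y _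

variable (W) in
/-- The path of windows is a measurable function of the path. -/
theorem measurable_windowPath : Measurable (windowPath W : (ℕ → S) → ℕ → (Fin (W + 1) → S)) :=
  measurable_pi_lambda _ fun _ => measurable_pi_lambda _ fun _ => measurable_pi_apply _

/-- Each window is a measurable function of the path. -/
theorem measurable_windowPath_at (k : ℕ) : Measurable fun x : ℕ → S => windowPath W x k :=
  measurable_pi_lambda _ fun _ => measurable_pi_apply _

end Measurability

variable [MeasurableSpace S]

/-! ## The sliding-window kernel -/

section WindowKernel

variable (κ : Kernel S S) [IsMarkovKernel κ] (W : ℕ)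

/-- **The sliding-window kernel** on `Fin (W + 1) → S`: from the window `y`, move to
`(y_1, …, y_W, s)` with `s ∼ κ(y_W, ·)`. [ours] -/
def windowKernel : Kernel (Fin (W + 1) → S) (Fin (W + 1) → S) :=
  Kernel.map (Kernel.id ×ₖ κ.comap (fun y : Fin (W + 1) → S => y (Fin.last W)) (measurable_pi_apply _))
    (fun p : (Fin (W + 1) → S) × S => shiftIn W p.1 p.2)

/-- `κ_W(y) = κ(y_W, ·).map (shiftIn W y)`. -/
theorem windowKernel_apply (y : Fin (W + 1) → S) :
    windowKernel κ W y = (κ (y (Fin.last W))).map (shiftIn W y) := by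
  rw [windowKernel, Kernel.map_apply _ (measurable_shiftIn measurable_fst measurable_snd),
    Kernel.prod_apply, Kernel.id_apply, Kernel.comap_apply, Measure.dirac_prod,
    Measure.map_map (measurable_shiftIn measurable_fst measurable_snd) measurable_prodMk_left]
  rfl

/-- The sliding-window kernel is a Markov kernel. -/
instance isMarkovKernel_windowKernel : IsMarkovKernel (windowKernel κ W) :=
  Kernel.IsMarkovKernel.map _ (measurable_shiftIn measurable_fst measurable_snd)

/-- **Its transition operator**: `(κ_W g)(y) = ∫ g(shiftIn W y s) κ(y_W, ds)`. -/
theorem kop_windowKernel {g : (Fin (W + 1) → S) → ℝ} (hg : Measurable g) (y : Fin (W + 1) → S) :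
    kop (windowKernel κ W) g y = ∫ s, g (shiftIn W y s) ∂(κ (y (Fin.last W))) := by
  show ∫ v, g v ∂(windowKernel κ W y) = _
  rw [windowKernel_apply, integral_map (measurable_shiftIn_right y).aemeasurable hg.aestronglyMeasurable]

end WindowKernel

/-! ## The `n`-step transition operator of the window kernel as a path integral -/

section Iterate

variable (κ : Kernel S S) [IsMarkovKernel κ]

/-- Bookkeeping: `∫ G(x_0) dP_{μ₀} = ∫ G dμ₀`. -/
theorem chain_integral_eval_zero (μ₀ : Measure S) [IsProbabilityMeasure μ₀] {G : S → ℝ}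
    (hG : Measurable G) :
    ∫ x, G (x 0) ∂(Kernel.trajMeasure (X := fun _ : ℕ => S) μ₀
        (fun n : ℕ => κ.comap (fun hh : (i : ↥(Finset.Iic n)) → S => hh ⟨n, Finset.mem_Iic.2 le_rfl⟩)
          (measurable_pi_apply _))) = ∫ z, G z ∂μ₀ := by
  rw [← integral_map (measurable_pi_apply 0).aemeasurable hG.aestronglyMeasurable, chain_map_eval_zero]

variable (W : ℕ)

/-- **THE `n`-STEP FORMULA.**  For bounded measurable `g`, every `n` and every window `y`:
`((κ_W)^n g)(y) = ∫ g(windowPath W (splicePath W y x) n) dP_{δ_{y_W}}(x)` — run the original chain from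
the newest coordinate, prepend the older coordinates of `y`, read the `n`-th window. -/
theorem iterate_kop_windowKernel {g : (Fin (W + 1) → S) → ℝ} (hg : Measurable g) {C : ℝ}
    (hC : ∀ v, |g v| ≤ C) (n : ℕ) (y : Fin (W + 1) → S) :
    (kop (windowKernel κ W))^[n] g y
      = ∫ x, g (windowPath W (splicePath W y x) n) ∂(Kernel.trajMeasure (X := fun _ : ℕ => S)
          (Measure.dirac (y (Fin.last W)))
          (fun n : ℕ => κ.comap (fun hh : (i : ↥(Finset.Iic n)) → S => hh ⟨n, Finset.mem_Iic.2 le_rfl⟩)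
            (measurable_pi_apply _))) := by
  induction n generalizing g with
  | zero =>
    -- the `0`-th window of the splice is `y` with its last coordinate replaced by `x_0 = y_W` a.s.
    have hGm : Measurable fun u : S =>
        g (fun i : Fin (W + 1) => if h : (i : ℕ) < W then y ⟨i, by omega⟩ else u) := by
      refine hg.comp (measurable_pi_lambda _ fun i => ?_)
      by_cases h : (i : ℕ) < W
      · simp only [h, dif_pos]; exact measurable_const
      · simp only [h, dif_neg, not_false_eq_true]; exact measurable_id
    rw [Function.iterate_zero, id_eq]
    simp_rw [windowPath_splicePath_zero]
    rw [chain_integral_eval_zero κ (Measure.dirac (y (Fin.last W))) hGm,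
      integral_dirac' _ _ hGm.stronglyMeasurable, replaceLast_self]
  | succ n ih =>
    set P := Kernel.trajMeasure (X := fun _ : ℕ => S) (Measure.dirac (y (Fin.last W)))
      (fun n : ℕ => κ.comap (fun hh : (i : ↥(Finset.Iic n)) → S => hh ⟨n, Finset.mem_Iic.2 le_rfl⟩)
        (measurable_pi_apply _)) with hP
    rw [Function.iterate_succ_apply, ih (measurable_kop _ hg) (abs_kop_le _ hC)]
    -- the joint tower identity at time `n` for the functional
    -- `H(x_{≤n}, s) = g(shiftIn W (n-th window of the splice) s)`
    set pad : ((i : ↥(Finset.Iic n)) → S) → ℕ → S := fun h k =>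
      if hk : k ≤ n then h ⟨k, Finset.mem_Iic.2 hk⟩ else h ⟨n, Finset.mem_Iic.2 le_rfl⟩ with hpad
    have hpadm : Measurable pad := measurable_padIic n
    have hpad_eq : ∀ (x : ℕ → S) (j : ℕ), j ≤ n → pad (frestrictLe n x) j = x j := fun x j hj => by
      simp only [hpad, hj, dif_pos]
      rfl
    set H : ((i : ↥(Finset.Iic n)) → S) × S → ℝ :=
      fun p => g (shiftIn W (windowPath W (splicePath W y (pad p.1)) n) p.2) with hH
    have hHm : Measurable H :=
      hg.comp (measurable_shiftIn ((measurable_windowPath_splicePath y n).comp (hpadm.comp measurable_fst))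
        measurable_snd)
    have hHC : ∀ p, |H p| ≤ C := fun p => hC _
    have key := chain_tower_joint κ (Measure.dirac (y (Fin.last W))) n hHm hHC
    rw [← hP] at key
    -- identify both sides
    have hL : ∀ x : ℕ → S, H (frestrictLe n x, x (n + 1)) = g (windowPath W (splicePath W y x) (n + 1)) :=
      fun x => by
        simp only [hH]
        rw [windowPath_splicePath_succ, shiftIn_windowPath_splicePath_congr y (hpad_eq x)]
    have hR : ∀ x : ℕ → S, (∫ s, H (frestrictLe n x, s) ∂(κ (x n)))
        = kop (windowKernel κ W) g (windowPath W (splicePath W y x) n) := fun x => by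
      rw [kop_windowKernel κ W hg, windowPath_splicePath_last]
      refine integral_congr_ae (ae_of_all _ fun s => ?_)
      simp only [hH]
      rw [shiftIn_windowPath_splicePath_congr y (hpad_eq x)]
    simp_rw [hL, hR] at key
    exact key.symm

end Iterate

end Summit.Ventures.LatticeQCDFlow.Scoring

end

/-! ## Appendix (GEN-9, appended): windows depend on finitely many coordinates

Used by `Scoring/SlidingWindowChain.lean` (the joint tower identities read a window through a padded
finite history): the `k`-th window of a path is determined by the path up to time `k + W`. -/

namespace Summit.Ventures.LatticeQCDFlow.Scoring

/-- **The `k`-th window of a path depends on the path only up to time `k + W`**: if `x` and `x'` agree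
up to time `n` and `k + W ≤ n`, then `windowPath W x k = windowPath W x' k`. -/
theorem windowPath_congr {S : Type*} {W : ℕ} {x x' : ℕ → S} {n k : ℕ} (h : ∀ j ≤ n, x j = x' j)
    (hk : k + W ≤ n) : windowPath W x k = windowPath W x' k := by
  funext i
  rw [windowPath_apply, windowPath_apply]
  exact h _ (by have := i.is_lt; omega)

end Summit.Ventures.LatticeQCDFlow.Scoring
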